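import Summits.AtomisticToContinuum.Crystallization.Theorems.FrustratedLawDichotomyGSCClusterExactness
import Summits.AtomisticToContinuum.Crystallization.Theorems.FrustratedLawDichotomyGSCChargedGapBridge
import Summits.AtomisticToContinuum.Crystallization.Theorems.FrustratedLawDichotomyFiniteClusterGapPrelude
import Summits.AtomisticToContinuum.Crystallization.Theorems.FrustratedLawDichotomyFolnerRadius
import Summits.AtomisticToContinuum.Crystallization.Theorems.ExcessDecayLiouvilleFarField
import Literature.MathematicalPhysics.StatisticalMechanics.LocalMatchingCompactness

/-!
# FrustratedLawDichotomy · crux `AperiodicFrustratedLawGap` (stmt-AtomisticToContinuum-27623) — VAN HOVE BALLS EXIST: the energy density of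
# an exact μ-equilibrium IS `e⋆`, unconditionally (configuration level; decomp-a2c, prover hand 2, structural share, generation 6)

`FrustratedLawDichotomyGSCClusterExactness` pins the energy per atom of the finite clusters of an `e⋆`-μ-ground-state configuration `X` of
Lennard-Jones to `e⋆` ALONG VAN HOVE FAMILIES (clusters whose cross-interaction with the rest is `o(#)`).  This module SUPPLIES such families
for every rooted `δ`-separated `X ⊆ ℝ³`, by the tree's ground-state-free Følner-radius combinatorics
(`FrustratedLawDichotomyFolnerRadius.stub_folnerRadius`: thin outer shells at radii `r ∈ [R/4, R/2]`) and the explicit `r⁻⁶` far field of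
separated sets (`ExcessDecayLiouville.sum_inv_pow_le_of_separated`):

* `not_isMuGSC_eStar_of_finite` / `infinite_of_isMuGSC_eStar` : a finite non-empty configuration is never an `e⋆`-μGSC (strict periodisation
  `n·e⋆ < U`, `FrustratedLawDichotomyFiniteClusterGap.card_mul_eStar_lt_interactionEnergy`, against the removal floor) — EXACT μ-EQUILIBRIA ARE
  INFINITE;
* `abs_tsum_field_le_of_far` : `|Σ'_{y ∈ Y} V_LJ(dist z y)| ≤ T(δ, Rc) := (δ⁻⁶/12 + 1/6)·1024/(δ³ Rc³)` when the `δ`-separated `Y` stays at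
  distance `≥ Rc ≥ δ` from `z`;
* `abs_cross_le_of_ball` : for the root-centred cluster `C = X ∩ B̄(0, r)` and any shell thickness `L`:
  `|I(C, X∖C)| ≤ n·T(δ, max L δ) + #{p ∈ C : r − L < ‖p‖}·T(δ, δ)`;
* `exists_vanHove_balls` : for every rooted `δ`-separated `X` there are radii `r_j ≥ j/4` and enumerations `xf_j` of `X ∩ B̄(0, r_j)` with
  `I(C_j, X∖C_j)/n_j → 0`;
* `exists_balls_energyPerAtom_tendsto_eStar` : hence every rooted `δ`-separated `e⋆`-μGSC of `V_LJ` has root-centred balls `C_j` exhausting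
  `X` with `U(C_j)/n_j → e⋆`, `n_j → ∞`, and `0 ≤ U(C_j) − E(n_j) ≤ U(C_j) − n_j·e⋆ = o(n_j)` — ARBITRARILY LARGE `o(N)`-APPROXIMATE GROUND STATES
  of the finite `N`-body problem sit inside every exact μ-equilibrium (`exists_nearGroundState_clusters`).

Reading for item 27623: the residual's hypothetical textured aperiodic `e⋆`-μGSC would contain, around its root, arbitrarily large
everywhere-`1/20`-bad finite clusters whose energy is within `o(N)` of the finite ground-state energy `E(N)` — the aperiodic law-free residual is
thereby confronted with every QUANTITATIVE finite crystallization statement (e.g. `PricedLinkCensus.ChargedEnergyGap`, bridged in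
`FrustratedLawDichotomyGSCChargedGapBridge`).  All `[folklore]`.
-/

noncomputable section

namespace Summit.AtomisticToContinuum.Crystallization.Theorems.FrustratedLawDichotomyGSCVanHoveBalls

open Filter Topology Metric
open Literature.MathematicalPhysics.StatisticalMechanics
open Summit.AtomisticToContinuum.Crystallization.Theorems.ChargedEnergyGapNegative (E3 eStar card_mul_eStar_le)
open Summit.AtomisticToContinuum.Crystallization.Theorems.FrustratedLawDichotomyGSCClusterExactness
  (interactionEnergy_le_of_isMuGSC interactionEnergy_sandwich tendsto_energyPerAtom)
open Summit.AtomisticToContinuum.Crystallization.Theorems.FrustratedLawDichotomyFiniteClusterGap (card_mul_eStar_lt_interactionEnergy)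
open Summit.AtomisticToContinuum.Crystallization.Theorems.ExcessDecayLiouville (sum_inv_pow_le_of_separated)
open Summit.AtomisticToContinuum.Crystallization.Theorems.FrustratedLawDichotomyFolnerRadius (stub_folnerRadius)
open Summit.AtomisticToContinuum.Crystallization.Theorems.FrustratedLawDichotomyGSCChargedGapBridge
  (tendsto_chargedFraction_zero_of_chargedEnergyGap)
open Summit.AtomisticToContinuum.Crystallization.Theorems.ChargedEnergyGapNegative (charged)
open Summit.AtomisticToContinuum.Crystallization.Theses.PricedLinkCensus (ChargedEnergyGap)

variable {δ : ℝ} {X Y : Set E3}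

/-! ## §1. Exact μ-equilibria are infinite -/

/-- **No finite non-empty configuration is an `e⋆`-μGSC of `V_LJ`**: removing everything would cost at most `e⋆·n` (removal floor), but
`n·e⋆ < U(X)` strictly (periodisation with far copies). [folklore] -/
theorem not_isMuGSC_eStar_of_finite (hfin : X.Finite) (hne : X.Nonempty) : ¬ IsMuGSC lennardJones eStar X := by
  intro h
  obtain ⟨n, f, hf⟩ := hfin.fin_embedding
  have hn : 0 < n := by
    obtain ⟨p, hp⟩ := hne
    rw [← hf] at hp
    obtain ⟨i, -⟩ := hp
    exact Fin.pos i
  have hle := interactionEnergy_le_of_isMuGSC h f.injective hf.le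
  have hempty : X \ Set.range f = ∅ := by rw [hf, Set.sdiff_self]
  haveI : IsEmpty ↥(X \ Set.range f) := by rw [hempty]; exact Set.isEmpty_coe_sort.2 rfl
  have h0 : ∑ i, ∑' y : ↥(X \ Set.range f), lennardJones (dist (f i) y) = 0 :=
    Finset.sum_eq_zero fun i _ => tsum_empty
  rw [h0, sub_zero] at hle
  have hlt := card_mul_eStar_lt_interactionEnergy hn f.injective
  linarith

/-- **Exact μ-equilibria are infinite**: a non-empty `e⋆`-μGSC of `V_LJ` is an infinite set. [folklore] -/
theorem infinite_of_isMuGSC_eStar (h : IsMuGSC lennardJones eStar X) (hne : X.Nonempty) : X.Infinite :=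
  fun hfin => not_isMuGSC_eStar_of_finite hfin hne h

/-! ## §2. The far field of a separated set, `tsum` form -/

/-- **Far-field bound**: if `Y ⊆ ℝ³` is `δ`-separated and every point of `Y` is at distance `≥ Rc ≥ δ > 0` from `z`, then
`|Σ'_{y ∈ Y} V_LJ(dist z y)| ≤ (δ⁻⁶/12 + 1/6)·1024/(δ³·Rc³)`. [folklore] -/
theorem abs_tsum_field_le_of_far (hδ : 0 < δ) (hsep : ∀ a ∈ Y, ∀ b ∈ Y, a ≠ b → δ ≤ dist a b)
    (z : E3) {Rc : ℝ} (hRc : δ ≤ Rc) (hfar : ∀ y ∈ Y, Rc ≤ dist z y) :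
    |∑' y : ↥Y, lennardJones (dist z y)| ≤ (δ⁻¹ ^ 6 / 12 + 1 / 6) * (1024 / (δ ^ 3 * Rc ^ 3)) := by
  classical
  have hY : UniformlyDiscrete Y := ⟨δ, hδ, hsep⟩
  have hsum : Summable fun y : ↥Y => lennardJones (dist z y) := hY.summable_lennardJones_dist z
  have habs : |∑' y : ↥Y, lennardJones (dist z y)| ≤ ∑' y : ↥Y, |lennardJones (dist z y)| := by
    have h0 : Summable fun y : ↥Y => ‖lennardJones (dist z y)‖ := hsum.norm
    have := norm_tsum_le_tsum_norm h0
    simpa only [Real.norm_eq_abs] using this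
  refine habs.trans (hsum.abs.tsum_le_of_sum_le fun u => ?_)
  set u' : Finset E3 := u.image Subtype.val with hu'
  have hmem : ∀ y ∈ u', y ∈ Y := fun y hy => by
    rw [hu', Finset.mem_image] at hy
    obtain ⟨w, -, rfl⟩ := hy
    exact w.2
  have hsum_eq : ∑ y ∈ u, |lennardJones (dist z y)| = ∑ y ∈ u', |lennardJones (dist z y)| := by
    rw [hu', Finset.sum_image (fun a _ b _ h => Subtype.ext h)]
  rw [hsum_eq]
  have hsep' : ∀ a ∈ u', ∀ b ∈ u', a ≠ b → δ ≤ dist a b := fun a ha b hb hab => hsep a (hmem a ha) b (hmem b hb) hab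
  have hfar' : ∀ y ∈ u', Rc ≤ dist y z := fun y hy => by rw [dist_comm]; exact hfar y (hmem y hy)
  have h6 : ∑ y ∈ u', (dist y z)⁻¹ ^ (3 + 3) ≤ 1024 / (δ ^ 3 * Rc ^ 3) :=
    sum_inv_pow_le_of_separated u' z (k := 3) (by norm_num) hδ hRc hsep' hfar'
  have hterm : ∀ y ∈ u', |lennardJones (dist z y)| ≤ (δ⁻¹ ^ 6 / 12 + 1 / 6) * (dist y z)⁻¹ ^ (3 + 3) := fun y hy => by
    rw [dist_comm]
    exact abs_lennardJones_le_of_le hδ (hRc.trans (hfar' y hy))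
  calc ∑ y ∈ u', |lennardJones (dist z y)| ≤ ∑ y ∈ u', (δ⁻¹ ^ 6 / 12 + 1 / 6) * (dist y z)⁻¹ ^ (3 + 3) :=
        Finset.sum_le_sum hterm
    _ = (δ⁻¹ ^ 6 / 12 + 1 / 6) * ∑ y ∈ u', (dist y z)⁻¹ ^ (3 + 3) := by rw [Finset.mul_sum]
    _ ≤ (δ⁻¹ ^ 6 / 12 + 1 / 6) * (1024 / (δ ^ 3 * Rc ^ 3)) := mul_le_mul_of_nonneg_left h6 (by positivity)

/-- The tail constant is antitone in the radius: `T(δ, Rc') ≤ T(δ, Rc)` for `0 < Rc ≤ Rc'`. [folklore] -/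
theorem tail_antitone (hδ : 0 < δ) {Rc Rc' : ℝ} (hRc : 0 < Rc) (h : Rc ≤ Rc') :
    (δ⁻¹ ^ 6 / 12 + 1 / 6) * (1024 / (δ ^ 3 * Rc' ^ 3)) ≤ (δ⁻¹ ^ 6 / 12 + 1 / 6) * (1024 / (δ ^ 3 * Rc ^ 3)) := by
  refine mul_le_mul_of_nonneg_left ?_ (by positivity)
  refine div_le_div_of_nonneg_left (by norm_num) (by positivity) ?_
  exact mul_le_mul_of_nonneg_left (pow_le_pow_left₀ hRc.le h 3) (by positivity)

/-! ## §3. The cross-interaction of a root-centred ball with the rest -/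

/-- **Ball estimate**: `X` `δ`-separated, `C = xf(Fin n) = X ∩ B̄(0, r)`; for any shell thickness `L`, the atoms deeper than `L` see the rest
at distance `≥ max L δ`, the others at distance `≥ δ`, so `|I(C, X∖C)| ≤ n·T(δ, max L δ) + #{i : r − L < ‖xf i‖}·T(δ, δ)`. [folklore] -/
theorem abs_cross_le_of_ball (hδ : 0 < δ) (hsep : ∀ a ∈ X, ∀ b ∈ X, a ≠ b → δ ≤ dist a b) {r L : ℝ}
    {n : ℕ} {xf : Fin n → E3} (hrange : Set.range xf = X ∩ closedBall 0 r) :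
    |∑ i, ∑' y : ↥(X \ Set.range xf), lennardJones (dist (xf i) y)| ≤
      (n : ℝ) * ((δ⁻¹ ^ 6 / 12 + 1 / 6) * (1024 / (δ ^ 3 * (max L δ) ^ 3))) +
        ((Finset.univ.filter fun i : Fin n => r - L < ‖xf i‖).card : ℝ) * ((δ⁻¹ ^ 6 / 12 + 1 / 6) * (1024 / (δ ^ 3 * δ ^ 3))) := by
  classical
  set T₁ : ℝ := (δ⁻¹ ^ 6 / 12 + 1 / 6) * (1024 / (δ ^ 3 * (max L δ) ^ 3)) with hT₁
  set T₀ : ℝ := (δ⁻¹ ^ 6 / 12 + 1 / 6) * (1024 / (δ ^ 3 * δ ^ 3)) with hT₀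
  have hsepY : ∀ a ∈ X \ Set.range xf, ∀ b ∈ X \ Set.range xf, a ≠ b → δ ≤ dist a b :=
    fun a ha b hb hab => hsep a ha.1 b hb.1 hab
  have hxX : ∀ i, xf i ∈ X := fun i => (hrange ▸ Set.mem_range_self i : xf i ∈ X ∩ closedBall 0 r).1
  have hxr : ∀ i, ‖xf i‖ ≤ r := fun i => by
    have := (hrange ▸ Set.mem_range_self i : xf i ∈ X ∩ closedBall 0 r).2
    rwa [mem_closedBall, dist_zero_right] at this
  -- every atom: the rest is at distance `≥ δ`
  have hall : ∀ i, |∑' y : ↥(X \ Set.range xf), lennardJones (dist (xf i) y)| ≤ T₀ := fun i => by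
    refine abs_tsum_field_le_of_far hδ hsepY (xf i) le_rfl fun y hy => ?_
    exact hsep (xf i) (hxX i) y hy.1 fun h => hy.2 (h ▸ Set.mem_range_self i)
  -- deep atoms: the rest is at distance `≥ max L δ`
  have hdeep : ∀ i, ‖xf i‖ ≤ r - L → |∑' y : ↥(X \ Set.range xf), lennardJones (dist (xf i) y)| ≤ T₁ := fun i hi => by
    refine abs_tsum_field_le_of_far hδ hsepY (xf i) (le_max_right L δ) fun y hy => ?_
    refine max_le ?_ (hsep (xf i) (hxX i) y hy.1 fun h => hy.2 (h ▸ Set.mem_range_self i))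
    -- `‖y‖ > r` since `y ∈ X` is not in the ball
    have hyr : r < ‖y‖ := by
      by_contra hle
      exact hy.2 (hrange ▸ ⟨hy.1, by rw [mem_closedBall, dist_zero_right]; exact not_lt.1 hle⟩)
    have h1 : ‖y‖ - ‖xf i‖ ≤ dist (xf i) y := by
      rw [dist_comm, dist_eq_norm]; exact norm_sub_norm_le y (xf i)
    linarith
  have T₁_nonneg : 0 ≤ T₁ := by rw [hT₁]; positivity
  have T₀_nonneg : 0 ≤ T₀ := by rw [hT₀]; positivity
  -- sum the two kinds
  set s : Finset (Fin n) := Finset.univ.filter fun i : Fin n => r - L < ‖xf i‖ with hs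
  calc |∑ i, ∑' y : ↥(X \ Set.range xf), lennardJones (dist (xf i) y)|
      ≤ ∑ i, |∑' y : ↥(X \ Set.range xf), lennardJones (dist (xf i) y)| := Finset.abs_sum_le_sum_abs _ _
    _ ≤ ∑ i, (T₁ + if r - L < ‖xf i‖ then T₀ else 0) := by
        refine Finset.sum_le_sum fun i _ => ?_
        by_cases hi : r - L < ‖xf i‖
        · rw [if_pos hi]; linarith [hall i]
        · rw [if_neg hi, add_zero]; exact hdeep i (by linarith [not_lt.1 hi])
    _ = (n : ℝ) * T₁ + (s.card : ℝ) * T₀ := by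
        rw [Finset.sum_add_distrib, Finset.sum_const, Finset.card_univ, Fintype.card_fin, nsmul_eq_mul,
          Finset.sum_ite, Finset.sum_const_zero, add_zero, Finset.sum_const, nsmul_eq_mul]

/-! ## §4. Van Hove balls exist around the root of every separated configuration -/

/-- **One radius**: given the Følner-radius property at scale `R ≥ 0` (thin outer shell of thickness `Ls R`, relative mass `≤ εs R`), the
root-centred ball cluster at the Følner radius `r ∈ [R/4, R/2]` has `|I(C, X∖C)|/n ≤ T(δ, max (Ls R) δ) + εs R · T(δ, δ)`. [folklore] -/
theorem exists_ball_cluster (hδ : 0 < δ) (hsep : ∀ a ∈ X, ∀ b ∈ X, a ≠ b → δ ≤ dist a b) (h0 : (0 : E3) ∈ X)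
    {Ls εs : ℝ → ℝ}
    (hF : ∀ (R : ℝ) (N : ℕ) (y : Fin N → EuclideanSpace ℝ (Fin 3)) (i : Fin N), 0 ≤ R →
      (∀ a b : Fin N, a ≠ b → δ ≤ dist (y a) (y b)) →
      ∃ r : ℝ, R / 4 ≤ r ∧ r ≤ R / 2 ∧
        (((Finset.univ.filter (fun j : Fin N => r - Ls R < dist (y j) (y i) ∧ dist (y j) (y i) ≤ r))).card : ℝ) ≤
          εs R * (((Finset.univ.filter (fun j : Fin N => dist (y j) (y i) ≤ r))).card : ℝ))
    {R : ℝ} (hR : 0 ≤ R) :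
    ∃ (r : ℝ) (n : ℕ) (xf : Fin n → E3), R / 4 ≤ r ∧ Function.Injective xf ∧ Set.range xf = X ∩ closedBall 0 r ∧ 0 < n ∧
      |∑ i, ∑' y : ↥(X \ Set.range xf), lennardJones (dist (xf i) y)| / (n : ℝ) ≤
        (δ⁻¹ ^ 6 / 12 + 1 / 6) * (1024 / (δ ^ 3 * (max (Ls R) δ) ^ 3)) +
          εs R * ((δ⁻¹ ^ 6 / 12 + 1 / 6) * (1024 / (δ ^ 3 * δ ^ 3))) := by
  classical
  -- enumerate the finite truncation `X ∩ B̄(0, R)`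
  have hfin : (X ∩ closedBall (0 : E3) R).Finite :=
    finite_of_forall_le_dist_of_subset_closedBall hδ (fun p hp q hq hpq => hsep p hp.1 q hq.1 hpq) Set.inter_subset_right
  obtain ⟨N, y, hy⟩ := hfin.fin_embedding
  have hyX : ∀ j, y j ∈ X ∩ closedBall (0 : E3) R := fun j => hy ▸ Set.mem_range_self j
  have h0mem : (0 : E3) ∈ Set.range y := by rw [hy]; exact ⟨h0, mem_closedBall_self hR⟩
  obtain ⟨i₀, hi₀⟩ := h0mem
  have hysep : ∀ a b : Fin N, a ≠ b → δ ≤ dist (y a) (y b) := fun a b hab =>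
    hsep (y a) (hyX a).1 (y b) (hyX b).1 fun h => hab (y.injective h)
  obtain ⟨r, hr1, hr2, hshell⟩ := hF R N y i₀ hR hysep
  have hyi₀ : ∀ j, dist (y j) (y i₀) = ‖y j‖ := fun j => by rw [hi₀, dist_zero_right]
  simp only [hyi₀] at hshell
  -- the ball cluster, re-indexed by `Fin n`
  set s : Finset (Fin N) := Finset.univ.filter fun j : Fin N => ‖y j‖ ≤ r with hs
  have hmem_s : ∀ j : Fin N, j ∈ s ↔ ‖y j‖ ≤ r := fun j => by simp [hs]
  set e := s.equivFin with he
  set xf : Fin s.card → E3 := fun m => y ((e.symm m : ↥s) : Fin N) with hxf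
  have hxf_inj : Function.Injective xf := fun a b hab =>
    e.symm.injective (Subtype.ext (y.injective hab))
  have hrange : Set.range xf = X ∩ closedBall 0 r := by
    ext p
    constructor
    · rintro ⟨m, rfl⟩
      refine ⟨(hyX _).1, ?_⟩
      rw [mem_closedBall, dist_zero_right]
      exact (hmem_s _).1 (e.symm m).2
    · rintro ⟨hpX, hpr⟩
      rw [mem_closedBall, dist_zero_right] at hpr
      have hpR : p ∈ X ∩ closedBall (0 : E3) R :=
        ⟨hpX, by rw [mem_closedBall, dist_zero_right]; linarith⟩
      rw [← hy] at hpR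
      obtain ⟨j, rfl⟩ := hpR
      refine ⟨e ⟨j, (hmem_s j).2 hpr⟩, ?_⟩
      simp only [hxf, Equiv.symm_apply_apply]
  have hnpos : 0 < s.card := by
    rw [Finset.card_pos]
    exact ⟨i₀, (hmem_s i₀).2 (by rw [hi₀, norm_zero]; linarith)⟩
  refine ⟨r, s.card, xf, hr1, hxf_inj, hrange, hnpos, ?_⟩
  -- the shell of `xf` of thickness `Ls R` injects into the Følner shell of `y`
  have hcard : ((Finset.univ.filter fun m : Fin s.card => r - Ls R < ‖xf m‖).card : ℝ) ≤
      ((Finset.univ.filter fun j : Fin N => r - Ls R < ‖y j‖ ∧ ‖y j‖ ≤ r).card : ℝ) := by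
    have h := Finset.card_le_card_of_injOn (s := Finset.univ.filter fun m : Fin s.card => r - Ls R < ‖xf m‖)
      (t := Finset.univ.filter fun j : Fin N => r - Ls R < ‖y j‖ ∧ ‖y j‖ ≤ r)
      (fun m : Fin s.card => ((e.symm m : ↥s) : Fin N))
      (fun m hm => by
        simp only [Finset.coe_filter, Finset.mem_univ, true_and, Set.mem_setOf_eq] at hm ⊢
        exact ⟨hm, (hmem_s _).1 (e.symm m).2⟩)
      (fun a _ b _ hab => e.symm.injective (Subtype.ext hab))
    exact_mod_cast h
  have hball : ((Finset.univ.filter fun j : Fin N => ‖y j‖ ≤ r).card : ℝ) = (s.card : ℝ) := by rw [hs]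
  have hI := abs_cross_le_of_ball hδ hsep (r := r) (L := Ls R) hrange
  have hnr : (0 : ℝ) < (s.card : ℝ) := by exact_mod_cast hnpos
  have hT₀ : 0 ≤ (δ⁻¹ ^ 6 / 12 + 1 / 6) * (1024 / (δ ^ 3 * δ ^ 3)) := by positivity
  have hshell' : ((Finset.univ.filter fun m : Fin s.card => r - Ls R < ‖xf m‖).card : ℝ) ≤ εs R * (s.card : ℝ) := by
    rw [← hball]; exact hcard.trans hshell
  rw [div_le_iff₀ hnr]
  have hmul := mul_le_mul_of_nonneg_right hshell' hT₀
  nlinarith [hI, hmul]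

/-- **VAN HOVE BALLS EXIST**: every rooted `δ`-separated `X ⊆ ℝ³` has root-centred ball clusters `C_j = X ∩ B̄(0, r_j)`, `r_j ≥ j/4`,
enumerated by injective `xf_j : Fin n_j → ℝ³`, whose cross-interaction per atom with the rest tends to zero. [folklore] -/
theorem exists_vanHove_balls (hδ : 0 < δ) (hsep : ∀ a ∈ X, ∀ b ∈ X, a ≠ b → δ ≤ dist a b) (h0 : (0 : E3) ∈ X) :
    ∃ (r : ℕ → ℝ) (n : ℕ → ℕ) (xf : ∀ j : ℕ, Fin (n j) → E3),
      (∀ j : ℕ, (j : ℝ) / 4 ≤ r j) ∧ (∀ j, Function.Injective (xf j)) ∧ (∀ j, Set.range (xf j) = X ∩ closedBall 0 (r j)) ∧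
      (∀ j, 0 < n j) ∧
      Tendsto (fun j => (∑ i, ∑' y : ↥(X \ Set.range (xf j)), lennardJones (dist (xf j i) y)) / (n j : ℝ)) atTop (𝓝 0) := by
  obtain ⟨Ls, εs, hLs, hεs, hF⟩ := stub_folnerRadius δ hδ
  have step := fun j : ℕ => exists_ball_cluster hδ hsep h0 (Ls := Ls) (εs := εs) hF (Nat.cast_nonneg j)
  choose r n xf hr hinj hrange hnpos hbound using step
  refine ⟨r, n, xf, hr, hinj, hrange, hnpos, ?_⟩
  -- the majorant tends to `0`
  set K : ℝ := δ⁻¹ ^ 6 / 12 + 1 / 6 with hK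
  have hmax : Tendsto (fun j : ℕ => max (Ls (j : ℝ)) δ) atTop atTop :=
    Filter.tendsto_atTop_mono (fun j => le_max_left _ _) (hLs.comp tendsto_natCast_atTop_atTop)
  have hden : Tendsto (fun j : ℕ => δ ^ 3 * (max (Ls (j : ℝ)) δ) ^ 3) atTop atTop :=
    ((tendsto_pow_atTop three_ne_zero).comp hmax).const_mul_atTop (by positivity)
  have h2 : Tendsto (fun j : ℕ => (1024 : ℝ) / (δ ^ 3 * (max (Ls (j : ℝ)) δ) ^ 3)) atTop (𝓝 0) :=
    tendsto_const_nhds.div_atTop hden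
  have h3 : Tendsto (fun j : ℕ => K * ((1024 : ℝ) / (δ ^ 3 * (max (Ls (j : ℝ)) δ) ^ 3))) atTop (𝓝 0) := by
    simpa only [mul_zero] using h2.const_mul K
  have h4 : Tendsto (fun j : ℕ => εs (j : ℝ) * (K * (1024 / (δ ^ 3 * δ ^ 3)))) atTop (𝓝 0) := by
    simpa only [zero_mul, Function.comp_def] using (hεs.comp tendsto_natCast_atTop_atTop).mul_const (K * (1024 / (δ ^ 3 * δ ^ 3)))
  have hb : Tendsto (fun j : ℕ => K * ((1024 : ℝ) / (δ ^ 3 * (max (Ls (j : ℝ)) δ) ^ 3)) + εs (j : ℝ) * (K * (1024 / (δ ^ 3 * δ ^ 3))))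
      atTop (𝓝 0) := by
    simpa only [add_zero] using h3.add h4
  refine squeeze_zero_norm (fun j => ?_) hb
  rw [Real.norm_eq_abs, abs_div, Nat.abs_cast]
  exact hbound j

/-! ## §5. Consequences for exact μ-equilibria -/

/-- **The energy density of an exact μ-equilibrium is `e⋆`**: every rooted `δ`-separated `e⋆`-μGSC of `V_LJ` has root-centred van Hove
balls `C_j` (`r_j ≥ j/4`) with `U(C_j)/n_j → e⋆`. [folklore] -/
theorem exists_balls_energyPerAtom_tendsto_eStar (hδ : 0 < δ) (hsep : ∀ a ∈ X, ∀ b ∈ X, a ≠ b → δ ≤ dist a b) (h0 : (0 : E3) ∈ X)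
    (h : IsMuGSC lennardJones eStar X) :
    ∃ (r : ℕ → ℝ) (n : ℕ → ℕ) (xf : ∀ j : ℕ, Fin (n j) → E3),
      (∀ j : ℕ, (j : ℝ) / 4 ≤ r j) ∧ (∀ j, Function.Injective (xf j)) ∧ (∀ j, Set.range (xf j) = X ∩ closedBall 0 (r j)) ∧
      (∀ j, 0 < n j) ∧
      Tendsto (fun j => (∑ i, ∑' y : ↥(X \ Set.range (xf j)), lennardJones (dist (xf j i) y)) / (n j : ℝ)) atTop (𝓝 0) ∧
      Tendsto (fun j => interactionEnergy lennardJones (xf j) / (n j : ℝ)) atTop (𝓝 eStar) := by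
  obtain ⟨r, n, xf, hr, hinj, hrange, hnpos, hI⟩ := exists_vanHove_balls hδ hsep h0
  exact ⟨r, n, xf, hr, hinj, hrange, hnpos, hI,
    tendsto_energyPerAtom h n xf hinj (fun j => (hrange j).le.trans Set.inter_subset_left) hnpos hI⟩

/-- Balls of radii `r_j ≥ j/4` around the root exhaust an infinite `X`: their atom counts tend to infinity. [folklore] -/
theorem tendsto_card_balls_atTop (hinf : X.Infinite) {r : ℕ → ℝ} {n : ℕ → ℕ} {xf : ∀ j : ℕ, Fin (n j) → E3}
    (hr : ∀ j : ℕ, (j : ℝ) / 4 ≤ r j) (hrange : ∀ j, Set.range (xf j) = X ∩ closedBall 0 (r j)) :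
    Tendsto n atTop atTop := by
  classical
  refine tendsto_atTop_atTop.2 fun M => ?_
  obtain ⟨t, htX, htcard⟩ := hinf.exists_subset_card_eq M
  set ρ : ℝ := ∑ p ∈ t, ‖p‖ with hρ
  have hρp : ∀ p ∈ t, ‖p‖ ≤ ρ := fun p hp =>
    Finset.single_le_sum (f := fun q => ‖q‖) (fun q _ => norm_nonneg q) hp
  refine ⟨⌈4 * ρ⌉₊, fun j hj => ?_⟩
  have hrj : ρ ≤ r j := by
    have h1 := hr j
    have h2 : (⌈4 * ρ⌉₊ : ℝ) ≤ j := by exact_mod_cast hj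
    linarith [Nat.le_ceil (4 * ρ)]
  have hsub : t ⊆ Finset.univ.image (xf j) := fun p hp => by
    have hp' : p ∈ Set.range (xf j) := by
      rw [hrange j]
      exact ⟨htX hp, by rw [mem_closedBall, dist_zero_right]; exact (hρp p hp).trans hrj⟩
    obtain ⟨m, hm⟩ := hp'
    exact Finset.mem_image.2 ⟨m, Finset.mem_univ _, hm⟩
  calc M = t.card := htcard.symm
    _ ≤ (Finset.univ.image (xf j)).card := Finset.card_le_card hsub
    _ ≤ (Finset.univ : Finset (Fin (n j))).card := Finset.card_image_le
    _ = n j := by rw [Finset.card_univ, Fintype.card_fin]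

/-- **NEAR-GROUND-STATE CLUSTERS INSIDE EVERY EXACT μ-EQUILIBRIUM.**  A rooted `δ`-separated `e⋆`-μGSC `X` of Lennard-Jones contains finite
clusters `C_j ⊆ X` of sizes `n_j → ∞` with `n_j·e⋆ ≤ E(n_j) ≤ U(C_j)` and `(U(C_j) − n_j·e⋆)/n_j → 0`: arbitrarily large
`o(N)`-approximate ground states of the finite `N`-body problem. [folklore] -/
theorem exists_nearGroundState_clusters (hδ : 0 < δ) (hsep : ∀ a ∈ X, ∀ b ∈ X, a ≠ b → δ ≤ dist a b) (h0 : (0 : E3) ∈ X)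
    (h : IsMuGSC lennardJones eStar X) :
    ∃ (n : ℕ → ℕ) (xf : ∀ j : ℕ, Fin (n j) → E3),
      (∀ j, Function.Injective (xf j)) ∧ (∀ j, Set.range (xf j) ⊆ X) ∧ Tendsto n atTop atTop ∧
      (∀ j, (n j : ℝ) * eStar ≤ groundStateEnergy lennardJones 3 (n j)) ∧
      (∀ j, groundStateEnergy lennardJones 3 (n j) ≤ interactionEnergy lennardJones (xf j)) ∧
      Tendsto (fun j => (interactionEnergy lennardJones (xf j) - (n j : ℝ) * eStar) / (n j : ℝ)) atTop (𝓝 0) := by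
  obtain ⟨r, n, xf, hr, hinj, hrange, hnpos, -, hU⟩ := exists_balls_energyPerAtom_tendsto_eStar hδ hsep h0 h
  have hinf : X.Infinite := infinite_of_isMuGSC_eStar h ⟨0, h0⟩
  refine ⟨n, xf, hinj, fun j => (hrange j).le.trans Set.inter_subset_left, tendsto_card_balls_atTop hinf hr hrange,
    fun j => ?_, fun j => groundStateEnergy_lennardJones_le (hinj j), ?_⟩
  · have hnj : (0 : ℝ) < n j := by exact_mod_cast hnpos j
    have := ChargedEnergyGapNegative.eStar_le_groundStateEnergy_div (hnpos j)
    rwa [le_div_iff₀ hnj, mul_comm] at this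
  · have key : Tendsto (fun j => interactionEnergy lennardJones (xf j) / (n j : ℝ) - eStar) atTop (𝓝 0) := by
      simpa only [sub_self] using hU.sub_const eStar
    refine key.congr fun j => ?_
    have hnj : (n j : ℝ) ≠ 0 := by exact_mod_cast (hnpos j).ne'
    rw [sub_div, mul_div_cancel_left₀ _ hnj]

/-- **Under `ChargedEnergyGap`, exact μ-equilibria are asymptotically all-charge-free around the root** (no van Hove hypothesis left):
every rooted `δ`-separated `e⋆`-μGSC of `V_LJ` has root-centred balls `C_j` (`r_j ≥ j/4`, `n_j → ∞` by `tendsto_card_balls_atTop`) with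
`charged_{1/100}(C_j)/n_j → 0`.  The residual configuration of item 27623 is everywhere `1/20`-bad. [folklore] -/
theorem exists_balls_chargedFraction_tendsto_zero (hgap : ChargedEnergyGap) (hδ : 0 < δ)
    (hsep : ∀ a ∈ X, ∀ b ∈ X, a ≠ b → δ ≤ dist a b) (h0 : (0 : E3) ∈ X) (h : IsMuGSC lennardJones eStar X) :
    ∃ (r : ℕ → ℝ) (n : ℕ → ℕ) (xf : ∀ j : ℕ, Fin (n j) → E3),
      (∀ j : ℕ, (j : ℝ) / 4 ≤ r j) ∧ (∀ j, Function.Injective (xf j)) ∧ (∀ j, Set.range (xf j) = X ∩ closedBall 0 (r j)) ∧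
      Tendsto n atTop atTop ∧
      Tendsto (fun j => (charged (1 / 100) (xf j) : ℝ) / (n j : ℝ)) atTop (𝓝 0) := by
  obtain ⟨r, n, xf, hr, hinj, hrange, hnpos, hI⟩ := exists_vanHove_balls hδ hsep h0
  have hinf : X.Infinite := infinite_of_isMuGSC_eStar h ⟨0, h0⟩
  exact ⟨r, n, xf, hr, hinj, hrange, tendsto_card_balls_atTop hinf hr hrange,
    tendsto_chargedFraction_zero_of_chargedEnergyGap hgap h n xf hinj
      (fun j => (hrange j).le.trans Set.inter_subset_left) hnpos hI⟩

end Summit.AtomisticToContinuum.Crystallization.Theorems.FrustratedLawDichotomyGSCVanHoveBalls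

end
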